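import Literature.Claims.NS.ClayVariants
import Mathlib.Analysis.SpecialFunctions.Complex.Circle
import HarnessLib

/-!
# Claim skeleton (D-0090 NS-CLAIMS, C112): Y. Wang, «Exercise X … Navier-Stokes Existence and Smoothness
# Revisited from the PAT Perspective», Zenodo 21917243 (2026) — Lean-artefact QUICK row

Cell `ns-claims`, row C112 (T2-low QUICK, «C81 treatment»; lead ruling 2026-08-26T20:50:52Z (2)), typist
`ns-claims-typist-12` (lanes: refuter-8, ref-4, salvage-p4 nominal, writer-2). Deposit of record (PINNED by
ns-claims-lit-1 g3, `pub/ns-claims/sources/Wang2026/LOCATORS.md` §0): Zenodo record 21917243 (DOI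
10.5281/zenodo.21917243, concept 21917242, the only version, 2026-08-13), bib `Wang2026PATNavierStokes`;
files `pat_pnp_exercise_i_10_navier_stokes_ZH.{tex,md,pdf}` (Chinese; locators «md l.N») and `lean_code.zip`
→ ONE Lean file `PatNavierStokesObservation.lean` (165 lines; locators «lean l.N»; it imports six
`Formal.Toolkit.*` modules that are NOT in the deposit; header «Lean 4 / mathlib v4.32.2»; no lakefile or
toolchain; not built here and NOT imported — its statements are TRANSCRIBED below over Mathlib). UNREFEREED
deposit under adjudication. NOTHING in this file asserts anything about Navier–Stokes: the transcribed
statements are elementary identities of `ℝ`/`ℂ` and are RE-PROVED here; the only Navier–Stokes-bearing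
sentence (the bridge to Clay (A)) is a `def … : Prop`, and the kernel facts about it are equivalences.
Card `pub/ns-claims/claims/Wang2026/CARD.md` (PREDICTION §4 frozen 21:32:02Z, sha16 3ee5331cb52edb08).

## What the deposit says (as printed)

* Zenodo description (verbatim): «Exercise X: Navier-Stokes revisited from the PAT perspective - fold-loss/
  recovery observation of existence and smoothness. Lean 4 / mathlib (PatNavierStokesObservation), all claims
  PROVED, no sorry.» md l.7: «Internal research exercise · Lean 4 / mathlib v4.32.2 · 6 new theorems PROVED
  no sorry». md l.13 (exercise statement, lit-1's translation from Chinese): «Navier–Stokes existence and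
  smoothness (Clay Millennium problem: 3D incompressible NS, smooth finite-energy initial velocity ⟹ a global
  smooth solution exists): re-observe using pat. Sole thesis: NS's folding loss = time direction (ν > 0
  viscosity irreversible) + numerical interlock (singularity collapse); recovery mechanism = time involution
  S² = id + unit-circle modulus ‖ρ(g)‖ = 1.» md l.27: «pat translation of the Millennium problem: existence =
  a solution persists after folding (the detachment projection keeps the interlock); smoothness = the
  numerical interlock is preserved (r·(1/r) = 1 does not collapse).»
* The artefact's declared theorems (lean l.96–162; six, all one-liners; the docstring's list l.73–81 names a
  seventh, `ns_three_terms_pat`, which does not occur in the file): `time_dual_reduces (t : ℝ) : -(-t) = t`;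
  `viscous_detachment (k) (θ : Fin k → ℝ) : ∀ j, cexp(θ j·I)·cexp(−θ j·I) = 1` (from an external toolkit
  lemma); `smoothness_numeric_interlock (r) (hr : r ≠ 0) : r * (1/r) = 1`; `singularity_fold_collapse (r)
  (hr : r = 0) : r = 0` (hypothesis = conclusion); `unit_circle_recovers (θ) : ‖cexp(θ·I)‖ = 1`; and the top
  theorem «★全景» (panorama) **`ns_pat_perspective (r : ℝ) (hr : r ≠ 0) (t θ : ℝ) : (-(-t) = t) ∧
  (r * (1 / r) = 1) ∧ (‖Complex.exp (θ * Complex.I)‖ = 1)`** (lean l.156–162). Lake-free census (lit-1):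
  `sorry` 0 · `axiom` 0 · `opaque` 0 · `native_decide` 0. No declaration mentions a velocity field, an
  equation, a domain, a datum, a time interval, existence or smoothness.
* The deposit's own status text («诚实边界» = «honesty boundary»; lean l.67–71, l.149, l.153–155; md l.78,
  l.108, §六 l.124, §七 closing note), lit-1's translation: «A complete proof of existence + smoothness (the
  Millennium problem) is NOT within the capability of the framework — what this exercise delivers is a
  structural observation: what is lost under folding (the time direction + the numerical interlock) and the
  recovery mechanism (time involution + unit-circle modulus), labelled OBSERVATION/CONJECTURE»; «honesty
  boundary: structural observation (OBSERVATION/CONJECTURE), not a proof of the Millennium problem».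

## Typing (lead 20:50:52Z (2): «ClaimedTheorem := the artefact's top conjunction re-typed verbatim over
## Mathlib; Step_1 = "top theorem ⇒ Clay (A)/(B)" typed as the implication the deposit's framing asserts»)

`ClaimedTheorem` = the TYPE of `ns_pat_perspective`, universally closed, verbatim — PROVED
(`claimedTheorem_holds`; and all six declared statements: `artefactStatements_hold`). `Step_bridge` (resp.
`Step_bridgeB`) = «`ClaimedTheorem` ⇒ Clay (A) `ClayVariants.clayR3.Regularity`» (resp. ⇒ Clay (B)
`ClayVariants.clayPeriodic.Regularity`): the implication a reader of the TITLE and the Zenodo description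
(«… Existence and Smoothness … all claims PROVED») would have to supply — the deposit prints only the
IDENTIFICATION md l.27 / lean l.58–60 («smoothness = numerical interlock preserved»), labels it OBSERVATION,
and DISCLAIMS the implication (honesty boundary above). Kernel facts: `step_bridge_iff_clay :
Step_bridge ↔ ClayVariants.clayR3.Regularity` and `step_bridgeB_iff_clay` — since the top theorem is true,
the bridge IS the Millennium statement; the deposit contributes nothing toward the sentence of its title.

ORDERED INDEX (TYPING-HYGIENE 11): Step 0 = `ClaimedTheorem` (lean l.156–162; TRUE, proved) · Step 1 =
`Step_bridge` / `Step_bridgeB` (title + Zenodo description vs md l.27, lean l.67–71: the unprinted,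
disclaimed bridge) — typist's private flag: wrong problem on every axis (below). COMPOSITION: `clay_of_steps :
Step_bridge → ClayVariants.clayR3.Regularity` (with `claimedTheorem_holds`); there is nothing else to compose.

## Clay delta (reference `Literature.Claims.NS.ClayVariants`, axes Δ1–Δ8)

Nearest Clay statement: NONE — `ClaimedTheorem` is not an instance of the (A)–(D) schema on any axis: no
domain (Δ1), no equations (Δ2 — decisive: no Navier–Stokes or any differential equation occurs), no force
(Δ3), no data class (Δ4), no solution notion (Δ5), no conclusion about a flow (Δ6), no viscosity (Δ7), no
pressure (Δ8). md l.13 paraphrases Clay (A) («3D incompressible NS, smooth finite-energy initial velocity ⟹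
global smooth solution»); the bridge Steps target (A) and (B) as the lead's ruling names both.

Design notes. The artefact's namespace `ZeroRelative.PatNavierStokesObservation` and its toolkit imports are
not reproduced; `viscous_detachment`'s statement is re-proved from `Complex.exp_add` instead of the missing
toolkit lemma. No notation, no instance. Nothing about the author or the «PAT» framework beyond the typed
locators is asserted or assessed.

WHAT THIS IS NOT: not a claim about NS regularity or blow-up; not a claim about any author beyond the
typed locator.
-/

noncomputable section

namespace Literature.Claims.NS.Wang2026

/-! ### The artefact's statements, transcribed verbatim over Mathlib (and re-proved) -/

/-- **The claimed theorem = the artefact's top theorem `ns_pat_perspective` («★NS pat 全景», lean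
l.156–162), universally closed, verbatim**: for `r ≠ 0` and all real `t, θ`:
`(-(-t) = t) ∧ (r * (1 / r) = 1) ∧ (‖Complex.exp (θ * Complex.I)‖ = 1)`. Its docstring (l.151–155, lit-1's
translation): «time-involution reduction (−(−t) = t, R147) ∧ smoothness = numerical interlock preserved
(r·(1/r) = 1, R143) ∧ recovery = unit-circle modulus (‖exp(iθ)‖ = 1, R165) — … Honesty boundary: structural
observation …, not a proof of the Millennium problem» (the deposit's two label words are quoted in the module
docstring).
[cite: Wang2026PATNavierStokes, PatNavierStokesObservation.lean l.156–162] -/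
def ClaimedTheorem : Prop :=
  ∀ r : ℝ, r ≠ 0 → ∀ t θ : ℝ,
    (-(-t) = t) ∧ (r * (1 / r) = 1) ∧ (‖Complex.exp (θ * Complex.I)‖ = 1)

/-- The top theorem is TRUE — three one-line Mathlib identities (the artefact's own proof route l.158–162:
`ring`, `field_simp`, `Complex.norm_exp_ofReal_mul_I`). [cite: Wang2026PATNavierStokes, PatNavierStokesObservation.lean l.156–162] -/
theorem claimedTheorem_holds : ClaimedTheorem := by
  intro r hr t θ
  refine ⟨neg_neg t, ?_, Complex.norm_exp_ofReal_mul_I θ⟩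
  rw [mul_one_div_cancel hr]

/-- The six declared statements of the file (lean l.96–162), transcribed verbatim as one conjunction:
`time_dual_reduces`, `viscous_detachment`, `smoothness_numeric_interlock`, `singularity_fold_collapse`
(hypothesis = conclusion), `unit_circle_recovers`, `ns_pat_perspective`.
[cite: Wang2026PATNavierStokes, PatNavierStokesObservation.lean l.96–162] -/
def ArtefactStatements : Prop :=
  (∀ t : ℝ, -(-t) = t) ∧
  (∀ (k : ℕ) (θ : Fin k → ℝ) (j : Fin k),
      Complex.exp (θ j * Complex.I) * Complex.exp ((-(θ j)) * Complex.I) = 1) ∧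
  (∀ r : ℝ, r ≠ 0 → r * (1 / r) = 1) ∧
  (∀ r : ℝ, r = 0 → r = 0) ∧
  (∀ θ : ℝ, ‖Complex.exp (θ * Complex.I)‖ = 1) ∧
  ClaimedTheorem

/-- All six declared statements hold (elementary; `viscous_detachment` re-proved from `Complex.exp_add` in
place of the deposit's missing toolkit lemma `PatInterlockGrowth.k_pairs_independent_interlock`).
[cite: Wang2026PATNavierStokes, PatNavierStokesObservation.lean l.96–162] -/
theorem artefactStatements_hold : ArtefactStatements := by
  refine ⟨fun t => neg_neg t, ?_, fun r hr => by rw [mul_one_div_cancel hr], fun r hr => hr,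
    fun θ => Complex.norm_exp_ofReal_mul_I θ, claimedTheorem_holds⟩
  intro k θ j
  rw [← Complex.exp_add]
  have : (θ j : ℂ) * Complex.I + -(θ j : ℂ) * Complex.I = 0 := by ring
  rw [this, Complex.exp_zero]

/-! ### The bridge to Clay (the only Navier–Stokes-bearing sentence; unprinted as an implication, disclaimed
by the deposit) -/

/-- **Step 1 — the bridge «top theorem ⇒ Clay (A)»** (lead ruling 20:50:52Z (2): «typed as the implication
the deposit's framing asserts»). Framing: title «Navier-Stokes Existence and Smoothness Revisited from the
PAT Perspective» + Zenodo description «… observation of existence and smoothness … all claims PROVED, no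
sorry»; md l.13 states Clay (A) in words; md l.27 / lean l.58–60 print the IDENTIFICATION «existence = a
solution persists after folding; smoothness = numerical interlock preserved (r·(1/r) = 1)» labelled
OBSERVATION; lean l.67–71, l.153–155 and md §六/§七 DISCLAIM the implication («not a proof of the Millennium
problem»; the deposit's label words are quoted in the module docstring). Typed target: `ClayVariants.clayR3.Regularity` (= the summit conjunct, (A)).
Typist's flag: wrong problem on every axis (no object of the (A)–(D) schema occurs in `ClaimedTheorem`).
[cite: Wang2026PATNavierStokes, Zenodo description; md l.13, l.27; PatNavierStokesObservation.lean l.58–71, l.147–155] -/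
def Step_bridge : Prop :=
  ClaimedTheorem → ClayVariants.clayR3.Regularity

/-- **Step 1 (B) — the same bridge read toward Clay (B)** (periodic existence and smoothness,
`ClayVariants.clayPeriodic.Regularity`); the lead's ruling names «Clay (A)/(B)», the deposit names neither
domain. [cite: Wang2026PATNavierStokes, Zenodo description; md l.13] -/
def Step_bridgeB : Prop :=
  ClaimedTheorem → ClayVariants.clayPeriodic.Regularity

/-- **Kernel fact: the bridge IS Clay (A).** Since `ClaimedTheorem` holds outright, `Step_bridge` is
EQUIVALENT to `ClayVariants.clayR3.Regularity`: the machine-checked content contributes nothing toward the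
sentence of the title. [cite: Wang2026PATNavierStokes, PatNavierStokesObservation.lean l.67–71, l.156–162] -/
theorem step_bridge_iff_clay : Step_bridge ↔ ClayVariants.clayR3.Regularity :=
  ⟨fun h => h claimedTheorem_holds, fun h _ => h⟩

/-- The (B) reading likewise: `Step_bridgeB ↔ ClayVariants.clayPeriodic.Regularity`.
[cite: Wang2026PATNavierStokes, PatNavierStokesObservation.lean l.67–71, l.156–162] -/
theorem step_bridgeB_iff_clay : Step_bridgeB ↔ ClayVariants.clayPeriodic.Regularity :=
  ⟨fun h => h claimedTheorem_holds, fun h _ => h⟩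

/-- **COMPOSITION**: bridge ⇒ Clay (A) (the top theorem is discharged by `claimedTheorem_holds`); pure
logic. There is nothing else in the deposit to compose. [cite: Wang2026PATNavierStokes, Zenodo description; PatNavierStokesObservation.lean l.156–162] -/
theorem clay_of_steps (h : Step_bridge) : ClayVariants.clayR3.Regularity :=
  h claimedTheorem_holds

end Literature.Claims.NS.Wang2026

end
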